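import Literature.Computability.QuantumComplexity.MSubspaceSignReadoutCodeFP
import HarnessLib

/-!
# The M-subspace sign readout with a logarithmic rank defect: the relaxed machine

Topic `Literature/Computability/QuantumComplexity` (route `QuantumAdvantage/CubicForrelation`, the SIGNED cubic
problem `signedCubicForrelationProblem 2`). `MSubspaceSignReadoutMachine.lean` reads the sign of `Φ(f,g)` from
a certified HALF-dimensional subspace `V ≤ 𝔽₂ⁿ` carrying `g` affinely on every coset (rank test `2 · rank = n`,
`200` sampler rounds). This file RELAXES the rank test to a logarithmic defect — for a fixed `c'`, a row list
is certified (`certOKR c'`) when its rank `r` has `n ≤ 2r + c' ⌊log₂ (n + 2)⌋` (and, as before, all second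
differences of the second circuit along two rows vanish at `0ⁿ` and the unit vectors) — and compensates the
smaller mean `2^{r - n/2} Φ` of a round (`|mean|² ≥ Φ² / (n+2)^{c'}`) by a polynomial number of rounds
`roundsR c' n = 200 (n + 2)^{c'}` (`negCountN`, `voteN`: the vote over `N` rounds; `negCount`/`vote` are the
case `N = 200`). Everything else — the test points, the row reduction, the dual-pair sampler `xOf`/`rbit`, the
six finder runs on the instance and its circuit-swap — is the machine of `MSubspaceSignReadoutMachine.lean`
verbatim (`certAtR`, `firstCertR`, `answerR`, `outR`, `coinPolyR` mirror `certAt`, …, `coinPoly`).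

Second part: the relaxed machine runs in polynomial time (`outR_codeFP`, **`exists_fp_outR`**), assembled from
the bricks of `MSubspaceSignReadoutCodeFP.lean` (the binary logarithm is the capped doubling scan
`CodeFP.natLog2Min`, the number of rounds a fixed polynomial of the unary dimension).

## References

* C. Carlet, *Boolean Functions for Cryptography and Coding Theory*, CUP 2020, Prop. 54, §6.1.5. [Carlet2020]
* S. Aaronson, A. Ambainis, *Forrelation*, SIAM J. Comput. 47 (2018), §1.1.1, §6. [AaronsonAmbainis2018]
* O. Goldreich, *On promise problems*, 2006, Def. 1.2 (promise-BPP). [Goldreich2006]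
* S. Arora, B. Barak, *Computational Complexity: A Modern Approach*, CUP 2009, §1.3, §7.4.1. [AroraBarak2009]
-/

noncomputable section

namespace Literature.Computability.QuantumComplexity

namespace MMReadout

open _root_.Computability Literature.Computability.Complexity Literature.Computability.Complexity.CodeFP
open Literature.Computability.Complexity.Brick (decNil)
open Literature.Computability.Complexity.F2Elim (bxorL Row rrun isPiv prow kvec bitsE stCE)
open ForrCode QuadSampler CubicDequant

/-! ### The relaxed certificate and the vote over `N` rounds -/

/-- **The relaxed certificate check** of a list of rows `L` for the circuit `c` on `n` bits with defect
parameter `c'`: the rank `r` of the rows has `n ≤ 2r + c' ⌊log₂ (n + 2)⌋`, and every second difference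
`D_r D_s c` along two rows vanishes at `0ⁿ` and at the unit vectors. [cite: Carlet2020, Prop. 54] -/
def certOKR (c' n : ℕ) (c : PCirc) (L : List (List Bool)) : Bool :=
  decide (n ≤ 2 * npiv n (rrun n L) + c' * Nat.log 2 (n + 2)) &&
    (L.product L).all fun rs => (unitPts n).all fun y => !d2 c y rs.1 rs.2

/-- The number of rounds of the relaxed machine: `200 (n + 2)^{c'}`. [cite: AroraBarak2009, §7.4.1] -/
def roundsR (c' n : ℕ) : ℕ := 200 * (n + 2) ^ c'

/-- The number of NEGATIVE rounds among `N`, round `r` reading `z` at coin offset `a + 2rn` and `w` at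
`a + (2r+1)n`. [folklore] -/
def negCountN (N n : ℕ) (cf cg : PCirc) (S : List Row) (y : List Bool) (a : ℕ) : ℕ :=
  ((List.range N).filter fun r =>
      rbit n cf cg S (coinVec y n (a + 2 * r * n)) (coinVec y n (a + (2 * r + 1) * n))).length

/-- **The vote over `N` rounds**: `true` iff the positive rounds are a strict majority.
[cite: Goldreich2006, Def. 1.2] -/
def voteN (N n : ℕ) (cf cg : PCirc) (S : List Row) (y : List Bool) (a : ℕ) : Bool :=
  decide (2 * negCountN N n cf cg S y a < N)

/-- The machine's `negCount` is `negCountN` with `N = rounds`. [folklore] -/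
theorem negCount_eq_negCountN (n : ℕ) (cf cg : PCirc) (S : List Row) (y : List Bool) (a : ℕ) :
    negCount n cf cg S y a = negCountN rounds n cf cg S y a := rfl

/-- The machine's `vote` is `voteN` with `N = rounds`. [folklore] -/
theorem vote_eq_voteN (n : ℕ) (cf cg : PCirc) (S : List Row) (y : List Bool) (a : ℕ) :
    vote n cf cg S y a = voteN rounds n cf cg S y a := rfl

/-! ### The finder runs and the output -/

variable (c' : ℕ) (find : List Bool → List Bool)

/-- Run `j` is certified (relaxed): its rows pass `certOKR c'` for the SECOND circuit of its instance.
[folklore] -/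
def certAtR (t : Inst) (n P : ℕ) (y : List Bool) (j : ℕ) : Bool :=
  certOKR c' n (circAt (sideT t j) 1) (rowsAt find t P y j)

/-- The first certified run among the six, if any. [folklore] -/
def firstCertR (t : Inst) (n P : ℕ) (y : List Bool) : Option ℕ :=
  (List.range 6).find? (certAtR c' find t n P y)

/-- The answer attached to a certified run `j` (the vote over `roundsR c' n` rounds of the sampler for the
run's instance, its coins starting after the six finder blocks), or PASS (`ε`). [cite: Goldreich2006, Def. 1.2] -/
def answerR (t : Inst) (n P : ℕ) (y : List Bool) : Option ℕ → List Bool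
  | none => []
  | some j => [voteN (roundsR c' n) n (circAt (sideT t j) 0) (circAt (sideT t j) 1)
      (rrun n (rowsAt find t P y j)) y (6 * P)]

variable (pF : Polynomial ℕ)

/-- **The output of the relaxed machine** on the mirror instance `t`, the code length `ℓ` and the coins `y`:
under the guard `k = 2 ∧ n ≤ ℓ + 1`, the answer of the first certified finder run with coin blocks of length
`pF ℓ`; PASS otherwise. [cite: Goldreich2006, Def. 1.2] -/
def outR (t : Inst) (ℓ : ℕ) (y : List Bool) : List Bool :=
  if decide (t.2.1 = 2) && decide (t.1 ≤ ℓ + 1) then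
    answerR c' find t (nEff t ℓ) (pF.eval ℓ) y (firstCertR c' find t (nEff t ℓ) (pF.eval ℓ) y)
  else []

/-- The coin polynomial of the relaxed machine: six finder blocks and `2 · roundsR c' (ℓ + 1)` sampler
blocks of `ℓ + 1 ≥ n` coins. [folklore] -/
noncomputable def coinPolyR : Polynomial ℕ :=
  6 * pF + Polynomial.C 400 * (Polynomial.X + 3) ^ c' * (Polynomial.X + 1)

/-- `coinPolyR c' pF ℓ = 6 pF(ℓ) + 2 · roundsR c' (ℓ + 1) · (ℓ + 1)`. [folklore] -/
theorem coinPolyR_eval (ℓ : ℕ) :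
    (coinPolyR c' pF).eval ℓ = 6 * pF.eval ℓ + 2 * roundsR c' (ℓ + 1) * (ℓ + 1) := by
  simp [coinPolyR, roundsR]
  ring

/-- `roundsR` is monotone in the dimension. [folklore] -/
theorem roundsR_mono {m m' : ℕ} (h : m ≤ m') : roundsR c' m ≤ roundsR c' m' :=
  Nat.mul_le_mul_left _ (Nat.pow_le_pow_left (by omega) _)

/-! ### The relaxed machine runs in polynomial time -/

/-- `1ⁿ ↦ ⌊log₂ (n + 2)⌋` (the capped doubling scan with budget `n + 2`). [cite: AroraBarak2009, §1.3] -/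
theorem log2_codeFP : CodeFP unE natE (fun n => Nat.log 2 (n + 2)) := by
  have h2 : CodeFP unE unE (fun n => n + 2) := (unSucc.comp unSucc).congr fun _ => rfl
  refine (natLog2Min.comp ((natOfUn.comp h2).pair (replicateUnit.comp h2))).congr fun n => ?_
  simp only [List.length_replicate, id_eq]
  exact min_eq_right (Nat.log_le_self 2 _)

/-- `1ⁿ ↦ 1^{roundsR c' n}` (a fixed polynomial of a unary numeral). [cite: AroraBarak2009, §1.3] -/
theorem roundsR_codeFP : CodeFP unE unE (roundsR c') :=
  (unPoly (Polynomial.C 200 * (Polynomial.X + 2) ^ c')).congr fun n => by simp [roundsR]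

/-- **The relaxed certificate check on codes.** [cite: AroraBarak2009, §1.3] -/
theorem certOKR_codeFP : CodeFP CE bitE (fun t => certOKR c' t.1 t.2.1 t.2.2) := by
  have hn : CodeFP CE unE (fun t => t.1) := fst _ _
  have hL : CodeFP CE (rawE bitsE) (fun t => t.2.2) := (snd _ _).snd'
  have hS : CodeFP CE stCE (fun t => rrun t.1 t.2.2) := F2Elim.rrun_codeFP.comp (hn.pair hL)
  have h2r : CodeFP CE natE (fun t => 2 * npiv t.1 (rrun t.1 t.2.2)) :=
    natMul.comp ((const _ 2).pair (npiv_codeFP.comp (hn.pair hS)))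
  have hsl : CodeFP CE natE (fun t => c' * Nat.log 2 (t.1 + 2)) := natMul.comp ((const _ c').pair (log2_codeFP.comp hn))
  have hrank : CodeFP CE bitE (fun t => decide (t.1 ≤ 2 * npiv t.1 (rrun t.1 t.2.2) + c' * Nat.log 2 (t.1 + 2))) :=
    natLe.comp ((natOfUn.comp hn).pair (natAdd.comp (h2r.pair hsl)))
  -- inner `all` over the test points, context `(t, rs)`
  have hinner := CodeFP.all (σ := (ℕ × (PCirc × List (List Bool))) × (List Bool × List Bool))
    (eσ := pairE CE (pairE bitsE bitsE)) (eα := bitsE)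
    (p := fun q => !d2 q.1.1.2.1 q.2 q.1.2.1 q.1.2.2)
    (d2_codeFP.comp ((fst _ _).fst'.snd'.fst'.pair ((snd _ _).pair ((fst _ _).snd'.fst'.pair (fst _ _).snd'.snd')))).not
  have hpts : CodeFP (pairE CE (pairE bitsE bitsE)) (rawE bitsE) (fun q => unitPts q.1.1) := unitPts_codeFP.comp (fst _ _).fst'
  have hin : CodeFP (pairE CE (pairE bitsE bitsE)) bitE
      (fun q => (unitPts q.1.1).all fun y => !d2 q.1.2.1 y q.2.1 q.2.2) :=
    (hinner.comp ((CodeFP.id _).pair hpts)).congr fun _ => rfl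
  have houter := CodeFP.all (σ := ℕ × (PCirc × List (List Bool))) (eσ := CE) (eα := pairE bitsE bitsE)
    (p := fun q => (unitPts q.1.1).all fun y => !d2 q.1.2.1 y q.2.1 q.2.2) hin
  have hprod : CodeFP CE (rawE (pairE bitsE bitsE)) (fun t => t.2.2.product t.2.2) := (rawProduct bitsE bitsE).comp (hL.pair hL)
  have hall := houter.comp ((CodeFP.id _).pair hprod)
  exact (hrank.and hall).congr fun _ => rfl

/-- The count of negative rounds among `roundsR c' n`, on codes. [cite: AroraBarak2009, §1.3] -/
theorem negCountN_codeFP : CodeFP VE natE (fun t => negCountN (roundsR c' t.1.1) t.1.1 t.1.2.1 t.1.2.2 t.2.1 t.2.2.1 t.2.2.2) := by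
  -- item map: context `t : VE`, item `r`
  have hctx : CodeFP (pairE VE natE) (pairE unE (pairE pcE pcE)) (fun q => q.1.1) := (fst _ _).fst'
  have hnU : CodeFP (pairE VE natE) unE (fun q => q.1.1.1) := (fst _ _).fst'.fst'
  have hn : CodeFP (pairE VE natE) natE (fun q => q.1.1.1) := natOfUn.comp hnU
  have hS : CodeFP (pairE VE natE) stCE (fun q => q.1.2.1) := (fst _ _).snd'.fst'
  have hy : CodeFP (pairE VE natE) strE (fun q => q.1.2.2.1) := (fst _ _).snd'.snd'.fst'
  have ha : CodeFP (pairE VE natE) natE (fun q => q.1.2.2.2) := (fst _ _).snd'.snd'.snd'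
  have hr : CodeFP (pairE VE natE) natE (fun q => q.2) := snd _ _
  have h2r : CodeFP (pairE VE natE) natE (fun q => 2 * q.2) := natMul.comp ((const _ 2).pair hr)
  have hoz : CodeFP (pairE VE natE) natE (fun q => q.1.2.2.2 + 2 * q.2 * q.1.1.1) :=
    natAdd.comp (ha.pair (natMul.comp (h2r.pair hn)))
  have how : CodeFP (pairE VE natE) natE (fun q => q.1.2.2.2 + (2 * q.2 + 1) * q.1.1.1) :=
    natAdd.comp (ha.pair (natMul.comp ((natAdd.comp (h2r.pair (const _ 1))).pair hn)))
  have hz : CodeFP (pairE VE natE) bitsE (fun q => coinVec q.1.2.2.1 q.1.1.1 (q.1.2.2.2 + 2 * q.2 * q.1.1.1)) :=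
    coinVec_codeFP.comp (hy.pair (hnU.pair hoz))
  have hw : CodeFP (pairE VE natE) bitsE (fun q => coinVec q.1.2.2.1 q.1.1.1 (q.1.2.2.2 + (2 * q.2 + 1) * q.1.1.1)) :=
    coinVec_codeFP.comp (hy.pair (hnU.pair how))
  have hb := rbit_codeFP.comp (hctx.pair (hS.pair (hz.pair hw)))
  have hf := CodeFP.filter (σ := (ℕ × (PCirc × PCirc)) × (List Row × (List Bool × ℕ))) (eσ := VE) (eα := natE) hb
  have hN : CodeFP VE (rawE natE) (fun t => List.range (roundsR c' t.1.1)) :=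
    urange.comp ((roundsR_codeFP c').comp (fst _ _).fst')
  have h := (natLength natE).comp (hf.comp ((CodeFP.id _).pair hN))
  exact h.congr fun _ => rfl

/-- **The vote over `roundsR c' n` rounds on codes.** [cite: AroraBarak2009, §1.3] -/
theorem voteN_codeFP : CodeFP VE bitE (fun t => voteN (roundsR c' t.1.1) t.1.1 t.1.2.1 t.1.2.2 t.2.1 t.2.2.1 t.2.2.2) :=
  (natLt.comp ((natMul.comp ((const _ 2).pair (negCountN_codeFP c'))).pair
    (natOfUn.comp ((roundsR_codeFP c').comp (fst _ _).fst')))).congr fun _ => rfl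

variable {find} (hfind : find ∈ FP)
include hfind

/-- A run is certified (relaxed), on codes. [cite: AroraBarak2009, §1.3] -/
theorem certAtR_codeFP : CodeFP QE' bitE (fun t => certAtR c' find t.1 t.2.1 t.2.2.1 t.2.2.2.1 t.2.2.2.2) := by
  have ht : CodeFP QE' instE (fun t => t.1) := fst _ _
  have hn : CodeFP QE' unE (fun t => t.2.1) := (snd _ _).fst'
  have hrest : CodeFP QE' (pairE unE (pairE strE natE)) (fun t => t.2.2) := (snd _ _).snd'
  have hj : CodeFP QE' natE (fun t => t.2.2.2.2) := (snd _ _).snd'.snd'.snd'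
  have hrows := (rowsAt_codeFP hfind).comp (ht.pair hrest)
  have hside := sideT_codeFP.comp (ht.pair hj)
  have hc := (circAtC 1).comp hside
  have h := (certOKR_codeFP c').comp (hn.pair (hc.pair hrows))
  exact h.congr fun _ => rfl

/-- The first certified run (relaxed) on codes. [cite: AroraBarak2009, §1.3] -/
theorem firstCertR_codeFP : CodeFP OE (optE natE) (fun t => firstCertR c' find t.1 t.2.1 t.2.2.1 t.2.2.2) := by
  have ht : CodeFP (pairE OE natE) instE (fun q => q.1.1) := (fst _ _).fst'
  have hn : CodeFP (pairE OE natE) unE (fun q => q.1.2.1) := (fst _ _).snd'.fst'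
  have hP : CodeFP (pairE OE natE) unE (fun q => q.1.2.2.1) := (fst _ _).snd'.snd'.fst'
  have hy : CodeFP (pairE OE natE) strE (fun q => q.1.2.2.2) := (fst _ _).snd'.snd'.snd'
  have hj : CodeFP (pairE OE natE) natE (fun q => q.2) := snd _ _
  have hp := (certAtR_codeFP c' hfind).comp (ht.pair (hn.pair (hP.pair (hy.pair hj))))
  have hf := rawFind? (σ := Inst × (ℕ × (ℕ × List Bool))) (eσ := OE) (eα := natE) hp
  have h := hf.comp ((CodeFP.id _).pair (const _ (List.range 6)))
  exact h.congr fun _ => rfl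

/-- The relaxed answer attached to an optional certified run, on codes. [cite: AroraBarak2009, §1.3] -/
theorem answerR_codeFP :
    CodeFP (pairE OE (optE natE)) strE (fun t => answerR c' find t.1.1 t.1.2.1 t.1.2.2.1 t.1.2.2.2 t.2) := by
  -- the `some j` branch, context `(ctx, j)`
  have ht : CodeFP (pairE OE natE) instE (fun q => q.1.1) := (fst _ _).fst'
  have hnU : CodeFP (pairE OE natE) unE (fun q => q.1.2.1) := (fst _ _).snd'.fst'
  have hPU : CodeFP (pairE OE natE) unE (fun q => q.1.2.2.1) := (fst _ _).snd'.snd'.fst'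
  have hy : CodeFP (pairE OE natE) strE (fun q => q.1.2.2.2) := (fst _ _).snd'.snd'.snd'
  have hj : CodeFP (pairE OE natE) natE (fun q => q.2) := snd _ _
  have hside := sideT_codeFP.comp (ht.pair hj)
  have hc0 := (circAtC 0).comp hside
  have hc1 := (circAtC 1).comp hside
  have hrows := (rowsAt_codeFP hfind).comp (ht.pair (hPU.pair (hy.pair hj)))
  have hS := F2Elim.rrun_codeFP.comp (hnU.pair hrows)
  have ha := natMul.comp ((const (pairE OE natE) 6).pair (natOfUn.comp hPU))
  have hv := (voteN_codeFP c').comp ((hnU.pair (hc0.pair hc1)).pair (hS.pair (hy.pair ha)))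
  have hsome := bitStr_codeFP.comp hv
  have h := optCases (σ := Inst × (ℕ × (ℕ × List Bool))) (eσ := OE) (eα := natE) (eδ := strE)
    (k := fun s o => answerR c' find s.1 s.2.1 s.2.2.1 s.2.2.2 o) (gnone := fun _ => []) (const _ []) hsome
    (fun _ => rfl) (fun _ _ => rfl)
  exact h.congr fun _ => rfl

/-- **The relaxed output on codes**: `(instance code, coins) ↦ outR c' find pF t |code| y`.
[cite: AroraBarak2009, §1.3] -/
theorem outR_codeFP (pF : Polynomial ℕ) :
    CodeFP (pairE instE strE) strE (fun p => outR c' find pF p.1 (instE p.1).length p.2) := by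
  have ht : CodeFP (pairE instE strE) instE (fun p => p.1) := fst _ _
  have hy : CodeFP (pairE instE strE) strE (fun p => p.2) := snd _ _
  have hL : CodeFP (pairE instE strE) unE (fun p => (instE p.1).length) := instLen_codeFP.comp ht
  have hL1 : CodeFP (pairE instE strE) unE (fun p => (instE p.1).length + 1) := unSucc.comp hL
  have hn : CodeFP (pairE instE strE) natE (fun p => p.1.1) := instN_codeFP.comp ht
  have hk : CodeFP (pairE instE strE) bitE (fun p => decide (p.1.2.1 = 2)) := natEq.comp ((instK_codeFP.comp ht).pair (const _ 2))
  have hg : CodeFP (pairE instE strE) bitE (fun p => decide (p.1.1 ≤ (instE p.1).length + 1)) := natLeUn.comp (hn.pair hL1)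
  have hne : CodeFP (pairE instE strE) unE (fun p => nEff p.1 (instE p.1).length) := (unOfNatMin.comp (hL1.pair hn)).congr fun _ => rfl
  have hP : CodeFP (pairE instE strE) unE (fun p => pF.eval (instE p.1).length) := (unPoly pF).comp hL
  have hctx := ht.pair (hne.pair (hP.pair hy))
  have hans := (answerR_codeFP c' hfind).comp (hctx.pair ((firstCertR_codeFP c' hfind).comp hctx))
  have hall := (hk.and hg).ite hans (const _ [])
  refine hall.congr fun p => ?_
  dsimp only [outR]

/-- **The `FP` witness of the relaxed readout machine**: a polynomial-time string function agreeing with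
`outR` on `⟨encode I, y⟩`. [cite: Goldreich2006, Def. 1.2] -/
theorem exists_fp_outR (pF : Polynomial ℕ) : ∃ dec ∈ FP, ∀ (I : KForrelationInstance) (y : List Bool),
    dec (boolPair I.encode y) = outR c' find pF (instOf I) I.encode.length y := by
  have h := (outR_codeFP c' hfind pF).comp ((instOf_codeFP.comp (fst KForrelationInstance.encode strE)).pair (snd _ _))
  have h' : CodeFP (pairE KForrelationInstance.encode strE) strE
      (fun p => outR c' find pF (instOf p.1) p.1.encode.length p.2) := by
    refine h.congr fun p => ?_
    dsimp only
    rw [encode_eq]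
  obtain ⟨F, hF, hFo⟩ := h'
  exact ⟨F, hF, fun I y => hFo (I, y)⟩

end MMReadout

end Literature.Computability.QuantumComplexity

end
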